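import Mathlib
import HarnessLib
import Summits.CriticalPhenomena.CardyFormulaZ2.Theorems.CardyMagicRigidityMagicFormulaTStubEntire
import Summits.CriticalPhenomena.CardyFormulaZ2.Theorems.CardyMagicRigidityMagicFormulaTUVAssemblyToolkit
import Summits.CriticalPhenomena.CardyFormulaZ2.Theorems.CardyMagicRigidityMagicFormulaTStubBandExpMoment
import Summits.CriticalPhenomena.CardyFormulaZ2.Theorems.CardyMagicRigidityMagicFormulaTStubBandFirstMoment
import Summits.CriticalPhenomena.CardyFormulaZ2.Theorems.CardyMagicRigidityMagicFormulaTStubBandCentring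

/-!
# Line `Sketch` (v8) for crux `MagicFormulaT`, stub N `stub_normalFamily`: the complex-coupling
# nesting transforms are a normal family

Crux `Summit.CriticalPhenomena.CardyFormulaZ2.Theses.CardyMagicRigidity.MagicFormulaT`
(stmt-CriticalPhenomena-4836), line `Sketch`, registered skeleton v8, stub `stub_normalFamily`: for an
admissible density `f` (measurable, `|f| ≤ C`, `f = 0` off `B̄(0, R)`, `∫ f = 0`) and `ρ > 0` there is
`M` with `‖Φ_δ(t)‖ ≤ M` for all `‖t‖ ≤ ρ` and all small meshes `δ`, where
`Φ_δ(t) = E_{1/2}[∏_u 2cos(t·θ_u(f) + π/3)]` (`θ_u = u.nestingPhase f`, loops of `siteLoopConfig δ ω`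
under `triSitePercolation half`, i.e. the ensemble `tEns`).

Proof: the landed real-coupling UV machine, run for complex coupling.  With `κ₁ = πC`
(`|θ_u| ≤ κ₁ diam²`), `K = C·Leb(B̄(0,R))` (`|θ_u| ≤ K`) and the band width
`b = min r₀(C) (1/(2ρκ₁ + 2))` (`ρκ₁b² ≤ 1/2`, `b ≤ 1`), pathwise only the finitely many loops meeting
`B̄(0, R)` contribute (`stubEntire_finprod_eq_prod`); the `N_b` big ones (`diam ≥ b`, meeting
`B̄(0, max R b)`) cost `≤ 2e^{ρK+2}` each (`stubEntire_norm_prod_factor_le`); the small ones have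
`‖tθ_u‖ ≤ 1/2` and cost `‖2cos(z + π/3)‖ ≤ exp(−√3 Re z + 10‖z‖²)` (`nf_norm_factor_le_exp`:
`2cos(z+π/3) = 1 + g`, `g = (cos z − 1) − √3(sin z − z) − √3 z`, `‖cos z − 1‖, ‖sin z − z‖ ≤ ‖z‖²` by
`Complex.norm_exp_sub_one_sub_id_le`, `‖1 + g‖² = 1 + 2Re g + ‖g‖² ≤ exp(2Re g + ‖g‖²)`), so their
product is `≤ exp(−√3 Re(t) Θ_s + 10ρ²Θ₂)`, `Θ_s = Σ_{diam<b} θ_u`, `Θ₂ = Σ_{diam<b} θ_u²` (inner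
statistics over `B(0, |R|+2)` of band-restricted weights, `nf_finsum_band_eq_sum`).  AM–GM:
`‖integrand‖ ≤ XYZ ≤ X²/2 + Y⁴/4 + Z⁴/4` with `X² = e^{2log(2e^{ρK+2}) N_b}`, `Y⁴ = e^{−4√3 Re(t) Θ_s}`,
`Z⁴ = e^{40ρ²Θ₂}`; uniformly in `0 < δ < b`, `‖t‖ ≤ ρ`: `E X² ≤ C_K`
(`expMoment_ncard_bigLoops_meeting_le_ball`), `E Y⁴ ≤ exp(K₀(4√3ρ)²κ₁²(|R|+2)³b)` (`stub_bandExpMoment`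
and the EXACT centring `EΘ_s = 0`, `stub_bandCentring`), `E Z⁴ ≤ e^{40ρ²EΘ₂} E e^{40ρ²(Θ₂ − EΘ₂)}`
(`EΘ₂ ≤ K₁κ₁²(|R|+2)²b²` by `stub_bandFirstMoment`, then `stub_bandExpMoment` with
`|θ_u²| ≤ κ₁²b²diam²` on the band).  So `‖Φ_δ(t)‖ ≤ ∫‖integrand‖ ≤ C_K/2 + EY/4 + EZ/4 =: M`.
No named fact is used; no definition is introduced.
-/

noncomputable section

namespace Summit.CriticalPhenomena.CardyFormulaZ2.Cruxes.MagicFormulaT.LineSketch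

open MeasureTheory Filter Set Metric
open scoped Real Topology BigOperators ENNReal
open Literature.Probability.RandomPlanarGeometry Literature.Probability.Percolation
  Literature.Probability.LatticeModels
open Summit.CriticalPhenomena.CardyFormulaZ2.Cruxes.NestingRigidity.RingCloudTomography
open Summit.CriticalPhenomena.CardyFormulaZ2.Cruxes.NestingRigidity.PositiveConeWeightDoubling

/-! ## Complex analysis of one factor -/

open Complex in
/-- `‖cos z − 1‖ ≤ ‖z‖²` and `‖sin z − z‖ ≤ ‖z‖²` for `‖z‖ ≤ 1` (from `‖eˣ − 1 − x‖ ≤ ‖x‖²`). -/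
theorem nf_norm_cos_sub_one_le_and {z : ℂ} (hz : ‖z‖ ≤ 1) :
    ‖cos z - 1‖ ≤ ‖z‖ ^ 2 ∧ ‖sin z - z‖ ≤ ‖z‖ ^ 2 := by
  have hzI : ‖z * I‖ = ‖z‖ := by rw [norm_mul, norm_I, mul_one]
  have hzI' : ‖-z * I‖ = ‖z‖ := by rw [norm_mul, norm_neg, norm_I, mul_one]
  have hp : ‖exp (z * I) - 1 - z * I‖ ≤ ‖z‖ ^ 2 := by
    simpa only [hzI] using norm_exp_sub_one_sub_id_le (x := z * I) (by rw [hzI]; exact hz)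
  have hq : ‖exp (-z * I) - 1 - (-z * I)‖ ≤ ‖z‖ ^ 2 := by
    simpa only [hzI'] using norm_exp_sub_one_sub_id_le (x := -z * I) (by rw [hzI']; exact hz)
  have hc : 2 * (cos z - 1) = (exp (z * I) - 1 - z * I) + (exp (-z * I) - 1 - (-z * I)) := by
    linear_combination two_cos (x := z)
  have hs : 2 * (sin z - z) = ((exp (-z * I) - 1 - (-z * I)) - (exp (z * I) - 1 - z * I)) * I := by
    linear_combination two_sin (x := z) - 2 * z * I_sq
  refine ⟨?_, ?_⟩
  · have h : ‖2 * (cos z - 1)‖ ≤ 2 * ‖z‖ ^ 2 := hc ▸ (norm_add_le _ _).trans (by linarith)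
    rw [norm_mul, Complex.norm_two] at h
    linarith
  · have h : ‖2 * (sin z - z)‖ ≤ 2 * ‖z‖ ^ 2 := by
      rw [hs, norm_mul, norm_I, mul_one]; exact (norm_sub_le _ _).trans (by linarith)
    rw [norm_mul, Complex.norm_two] at h
    linarith

/-- **The complex twisted factor near zero phase**: `‖2cos(z + π/3)‖ ≤ exp(−√3 Re z + 10‖z‖²)` for
`‖z‖ ≤ 1/2` (`2cos(z + π/3) = 1 + g`, `g = (cos z − 1) − √3(sin z − z) − √3 z`,
`‖1 + g‖² = 1 + 2 Re g + ‖g‖² ≤ exp(2 Re g + ‖g‖²)`). -/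
theorem nf_norm_factor_le_exp {z : ℂ} (hz : ‖z‖ ≤ 1 / 2) :
    ‖2 * Complex.cos (z + (Real.pi : ℂ) / 3)‖ ≤
      Real.exp (-(Real.sqrt 3 * z.re) + 10 * ‖z‖ ^ 2) := by
  obtain ⟨hc, hs⟩ := nf_norm_cos_sub_one_le_and (hz.trans (by norm_num))
  have hn0 : 0 ≤ ‖z‖ := norm_nonneg z
  have h30 : 0 ≤ Real.sqrt 3 := Real.sqrt_nonneg 3
  have h32 : Real.sqrt 3 ≤ 2 := by nlinarith [Real.sq_sqrt (show (0 : ℝ) ≤ 3 by norm_num)]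
  set g : ℂ := 2 * Complex.cos (z + (Real.pi : ℂ) / 3) - 1 with hg
  have hg_eq : g = (Complex.cos z - 1) - ((Real.sqrt 3 : ℝ) : ℂ) * (Complex.sin z - z) -
      ((Real.sqrt 3 : ℝ) : ℂ) * z := by
    rw [hg, Complex.cos_add, stubEntire_cos_sin_pi_div_three.1, stubEntire_cos_sin_pi_div_three.2]
    ring
  have hsn : ‖((Real.sqrt 3 : ℝ) : ℂ)‖ = Real.sqrt 3 := by rw [Complex.norm_real, Real.norm_of_nonneg h30]
  have hgre : g.re ≤ -(Real.sqrt 3 * z.re) + 3 * ‖z‖ ^ 2 := by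
    rw [hg_eq, Complex.sub_re, Complex.sub_re, Complex.re_ofReal_mul, Complex.re_ofReal_mul]
    have h1 : (Complex.cos z - 1).re ≤ ‖z‖ ^ 2 := (Complex.re_le_norm _).trans hc
    have h2 : -(Complex.sin z - z).re ≤ ‖z‖ ^ 2 := by
      have := Complex.abs_re_le_norm (Complex.sin z - z)
      have := neg_abs_le (Complex.sin z - z).re
      linarith
    nlinarith
  have hgn : ‖g‖ ≤ 3 * ‖z‖ ^ 2 + 2 * ‖z‖ := by
    rw [hg_eq]
    refine (norm_sub_le _ _).trans ((add_le_add (norm_sub_le _ _) le_rfl).trans ?_)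
    rw [norm_mul, norm_mul, hsn]
    nlinarith [mul_le_mul_of_nonneg_left hs h30, mul_le_mul_of_nonneg_right h32 hn0,
      mul_le_mul_of_nonneg_right h32 (sq_nonneg ‖z‖)]
  have hnormsq : ‖1 + g‖ ^ 2 = 1 + 2 * g.re + ‖g‖ ^ 2 := by
    rw [Complex.sq_norm, Complex.sq_norm, Complex.normSq_apply, Complex.normSq_apply]
    simp only [Complex.add_re, Complex.one_re, Complex.add_im, Complex.one_im]
    ring
  have h2 : Real.exp (-(Real.sqrt 3 * z.re) + 10 * ‖z‖ ^ 2) ^ 2 =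
      Real.exp (2 * (-(Real.sqrt 3 * z.re) + 10 * ‖z‖ ^ 2)) := by
    rw [sq, ← Real.exp_add, two_mul]
  have hE : ‖1 + g‖ ^ 2 ≤ Real.exp (-(Real.sqrt 3 * z.re) + 10 * ‖z‖ ^ 2) ^ 2 := by
    rw [h2, hnormsq]
    refine le_trans ?_ (Real.add_one_le_exp _)
    have hg2 : ‖g‖ ^ 2 ≤ (3 * ‖z‖ ^ 2 + 2 * ‖z‖) ^ 2 := pow_le_pow_left₀ (norm_nonneg _) hgn 2
    have hn3 : ‖z‖ ^ 3 ≤ ‖z‖ ^ 2 / 2 := by nlinarith [sq_nonneg ‖z‖]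
    have hn4 : ‖z‖ ^ 4 ≤ ‖z‖ ^ 2 / 4 := by nlinarith [sq_nonneg ‖z‖, pow_le_pow_left₀ hn0 hz 2]
    nlinarith
  rw [show 2 * Complex.cos (z + (Real.pi : ℂ) / 3) = 1 + g by rw [hg]; ring]
  exact le_of_pow_le_pow_left₀ two_ne_zero (Real.exp_pos _).le hE

/-- AM–GM for three exponentials: `e^{q+r} e^p ≤ e^{2p}/2 + e^{4q}/4 + e^{4r}/4`. -/
theorem nf_exp_three_le (p q r : ℝ) :
    Real.exp (q + r) * Real.exp p ≤
      1 / 2 * Real.exp (2 * p) + 1 / 4 * Real.exp (4 * q) + 1 / 4 * Real.exp (4 * r) := by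
  have e2 : Real.exp (2 * p) = Real.exp p ^ 2 := by rw [sq, ← Real.exp_add, two_mul]
  have e4q : Real.exp (4 * q) = Real.exp q ^ 4 := by rw [← Real.exp_nat_mul]; norm_num
  have e4r : Real.exp (4 * r) = Real.exp r ^ 4 := by rw [← Real.exp_nat_mul]; norm_num
  rw [Real.exp_add, e2, e4q, e4r]
  nlinarith [sq_nonneg (Real.exp p - Real.exp q * Real.exp r), sq_nonneg (Real.exp q ^ 2 - Real.exp r ^ 2),
    Real.exp_pos p, Real.exp_pos q, Real.exp_pos r]

/-! ## The integrand over a loop family with finitely many loops meeting the ball -/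

section Family

variable {f : ℂ → ℝ} {R C : ℝ}

/-- **The band statistics are honest finite sums**: if finitely many loops of `L` meet `B̄(0, R)`,
`φ 0 = 0` and `b ≤ 1`, the inner statistic over `B(0, |R| + 2)` of the band-restricted `φ(θ_u)` is the
sum of `φ(θ_u)` over the loops of diameter `< b` meeting `B̄(0, R)` (`sw_meets_of_nestingPhase_ne_zero`,
`sw_range_subset_ball`). -/
theorem nf_finsum_band_eq_sum (hR : ∀ z, R < ‖z‖ → f z = 0) (h0 : ∫ z, f z = 0) {b : ℝ}
    (hb1 : b ≤ 1) {L : Set (UnbasedLoop ℂ)}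
    (hfin : {u ∈ L | (u.range ∩ closedBall (0 : ℂ) R).Nonempty}.Finite) (φ : ℝ → ℝ)
    (hφ : φ 0 = 0) :
    ∑ᶠ u ∈ {u ∈ L | u.range ⊆ ball (0 : ℂ) (|R| + 2)},
        (if 0 ≤ diam u.range ∧ diam u.range < b then φ (u.nestingPhase f) else 0) =
      ∑ u ∈ hfin.toFinset with diam u.range < b, φ (u.nestingPhase f) := by
  have hiff : ∀ u ∈ Function.support (fun u : UnbasedLoop ℂ ↦
      if 0 ≤ diam u.range ∧ diam u.range < b then φ (u.nestingPhase f) else 0),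
      u ∈ {u ∈ L | u.range ⊆ ball (0 : ℂ) (|R| + 2)} ↔
        u ∈ (↑(hfin.toFinset.filter fun u ↦ diam u.range < b) : Set (UnbasedLoop ℂ)) := by
    intro u hu
    obtain ⟨hband, hθφ⟩ := ite_ne_right_iff.1 hu
    have hθ : u.nestingPhase f ≠ 0 := fun h ↦ hθφ (by rw [h, hφ])
    simp only [Finset.coe_filter, Set.mem_setOf_eq, Set.Finite.mem_toFinset]
    exact ⟨fun h ↦ ⟨⟨h.1, sw_meets_of_nestingPhase_ne_zero hR h0 hθ⟩, hband.2⟩,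
      fun h ↦ ⟨h.1.1, sw_range_subset_ball hb1 u h.2 h.1.2⟩⟩
  rw [finsum_mem_inter_support_eq' _ _ _ hiff, finsum_mem_coe_finset]
  exact Finset.sum_congr rfl fun u hu ↦ if_pos ⟨diam_nonneg, (Finset.mem_filter.1 hu).2⟩

/-- The loops of diameter `≥ b` meeting `B̄(0, R)` are among those meeting the larger `B̄(0, R')`. -/
theorem nf_card_filter_big_le {b R' : ℝ} (hRR' : R ≤ R') {L : Set (UnbasedLoop ℂ)}
    (hfin : {u ∈ L | (u.range ∩ closedBall (0 : ℂ) R).Nonempty}.Finite)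
    (hfin' : {u ∈ L | (u.range ∩ closedBall (0 : ℂ) R').Nonempty}.Finite) :
    (hfin.toFinset.filter fun u ↦ ¬diam u.range < b).card ≤
      {u ∈ L | (u.range ∩ closedBall (0 : ℂ) R').Nonempty ∧ b ≤ diam u.range}.ncard := by
  rw [← Set.ncard_coe_finset]
  refine Set.ncard_le_ncard (fun u hu ↦ ?_) (hfin'.subset fun u hu ↦ ⟨hu.1, hu.2.1⟩)
  rw [Finset.coe_filter, Set.mem_setOf_eq, Set.Finite.mem_toFinset, Set.mem_setOf_eq] at hu
  obtain ⟨⟨huL, z, hz, hzR⟩, hnot⟩ := hu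
  exact ⟨huL, ⟨z, hz, closedBall_subset_closedBall hRR' hzR⟩, not_lt.1 hnot⟩

/-- **Pathwise bound on the complex-coupling integrand** over a loop family with finitely many loops
meeting `B̄(0, R')`, `R ≤ R'`: on `‖t‖ ≤ ρ`, with `ρ π C b² ≤ 1/2`, `b ≤ 1`,
`‖∏_u 2cos(t θ_u + π/3)‖ ≤ exp(−√3 Re(t) Θ_s + 10 ρ² Θ₂) · (2e^{ρK+2})^{N_b}`, where `Θ_s`, `Θ₂` are the
inner statistics over `B(0, |R| + 2)` of the band-restricted phase and squared phase (band `[0, b)`),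
`K = C · Leb(B̄(0, R))` and `N_b` is the number of loops of diameter `≥ b` meeting `B̄(0, R')`. -/
theorem nf_norm_finprod_le (hC : ∀ z, |f z| ≤ C) (hR : ∀ z, R < ‖z‖ → f z = 0) (h0 : ∫ z, f z = 0)
    {b R' ρ : ℝ} (hb1 : b ≤ 1) (hρb : ρ * (π * C) * b ^ 2 ≤ 1 / 2) (hRR' : R ≤ R')
    {L : Set (UnbasedLoop ℂ)} (hfin : {u ∈ L | (u.range ∩ closedBall (0 : ℂ) R).Nonempty}.Finite)
    (hfin' : {u ∈ L | (u.range ∩ closedBall (0 : ℂ) R').Nonempty}.Finite) {t : ℂ} (ht : ‖t‖ ≤ ρ) :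
    ‖∏ᶠ u ∈ L, 2 * Complex.cos (t * ((u.nestingPhase f : ℝ) : ℂ) + (Real.pi : ℂ) / 3)‖ ≤
      Real.exp (-(Real.sqrt 3 * t.re) *
          (∑ᶠ u ∈ {u ∈ L | u.range ⊆ ball (0 : ℂ) (|R| + 2)},
            (if 0 ≤ diam u.range ∧ diam u.range < b then u.nestingPhase f else 0)) +
        10 * ρ ^ 2 * ∑ᶠ u ∈ {u ∈ L | u.range ⊆ ball (0 : ℂ) (|R| + 2)},
            (if 0 ≤ diam u.range ∧ diam u.range < b then u.nestingPhase f ^ 2 else 0)) *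
      (2 * Real.exp (ρ * (C * volume.real (closedBall (0 : ℂ) R)) + 2)) ^
        {u ∈ L | (u.range ∩ closedBall (0 : ℂ) R').Nonempty ∧ b ≤ diam u.range}.ncard := by
  have hρ : 0 ≤ ρ := (norm_nonneg t).trans ht
  have hθ1 : ∑ᶠ u ∈ {u ∈ L | u.range ⊆ ball (0 : ℂ) (|R| + 2)},
      (if 0 ≤ diam u.range ∧ diam u.range < b then u.nestingPhase f else 0) =
      ∑ u ∈ hfin.toFinset with diam u.range < b, u.nestingPhase f :=
    nf_finsum_band_eq_sum hR h0 hb1 hfin (fun x ↦ x) rfl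
  have hθ2 : ∑ᶠ u ∈ {u ∈ L | u.range ⊆ ball (0 : ℂ) (|R| + 2)},
      (if 0 ≤ diam u.range ∧ diam u.range < b then u.nestingPhase f ^ 2 else 0) =
      ∑ u ∈ hfin.toFinset with diam u.range < b, u.nestingPhase f ^ 2 :=
    nf_finsum_band_eq_sum hR h0 hb1 hfin (fun x ↦ x ^ 2) (by norm_num)
  rw [stubEntire_finprod_eq_prod hR h0 hfin t,
    ← Finset.prod_filter_mul_prod_filter_not hfin.toFinset (fun u ↦ diam u.range < b), norm_mul]
  refine mul_le_mul ?_ (stubEntire_norm_prod_factor_le hC hR _ (nf_card_filter_big_le hRR' hfin hfin') ht)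
    (norm_nonneg _) (Real.exp_pos _).le
  calc ‖∏ u ∈ hfin.toFinset with diam u.range < b,
          2 * Complex.cos (t * ((u.nestingPhase f : ℝ) : ℂ) + (Real.pi : ℂ) / 3)‖
      ≤ ∏ u ∈ hfin.toFinset with diam u.range < b,
          ‖2 * Complex.cos (t * ((u.nestingPhase f : ℝ) : ℂ) + (Real.pi : ℂ) / 3)‖ :=
        Finset.norm_prod_le _ _
    _ ≤ ∏ u ∈ hfin.toFinset with diam u.range < b,
          Real.exp (-(Real.sqrt 3 * t.re) * u.nestingPhase f + 10 * ρ ^ 2 * u.nestingPhase f ^ 2) := by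
        refine Finset.prod_le_prod (fun _ _ ↦ norm_nonneg _) fun u hu ↦ ?_
        have hd : diam u.range ^ 2 ≤ b ^ 2 :=
          pow_le_pow_left₀ diam_nonneg (Finset.mem_filter.1 hu).2.le 2
        have hz : ‖t * ((u.nestingPhase f : ℝ) : ℂ)‖ ≤ 1 / 2 := by
          rw [norm_mul, Complex.norm_real, Real.norm_eq_abs]
          have hπC : 0 ≤ ρ * (π * C) := mul_nonneg hρ (mul_nonneg Real.pi_pos.le (nonneg_of_abs_le hC))
          nlinarith [mul_le_mul ht (uva_abs_nestingPhase_le_sq hC hR u) (abs_nonneg _) hρ,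
            mul_le_mul_of_nonneg_left hd hπC]
        refine (nf_norm_factor_le_exp hz).trans (Real.exp_le_exp.2 ?_)
        rw [Complex.re_mul_ofReal, norm_mul, Complex.norm_real, Real.norm_eq_abs, mul_pow, sq_abs]
        have h1 : ‖t‖ ^ 2 * u.nestingPhase f ^ 2 ≤ ρ ^ 2 * u.nestingPhase f ^ 2 :=
          mul_le_mul_of_nonneg_right (pow_le_pow_left₀ (norm_nonneg t) ht 2) (sq_nonneg _)
        nlinarith [h1]
    _ = Real.exp (∑ u ∈ hfin.toFinset with diam u.range < b,
          (-(Real.sqrt 3 * t.re) * u.nestingPhase f + 10 * ρ ^ 2 * u.nestingPhase f ^ 2)) :=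
        (Real.exp_sum _ _).symm
    _ = _ := by rw [Finset.sum_add_distrib, ← Finset.mul_sum, ← Finset.mul_sum, ← hθ1, ← hθ2]

end Family

/-! ## The registered stub -/

/-- **Stub N (`stub_normalFamily`) · the complex-coupling transforms are a NORMAL FAMILY**: for an
admissible density `f` and `ρ > 0` there is `M` with `‖Φ_δ(t)‖ ≤ M` for all `‖t‖ ≤ ρ`, eventually as
`δ → 0⁺` (in fact for all `0 < δ < b(f, ρ)`).  UV split at diameter `b`: big loops by the keystone
exponential moments of their number, small loops by the complex sandwich
`‖2cos(z+π/3)‖ ≤ e^{−√3 Re z + 10‖z‖²}`, the band exponential moments, the exact band centring and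
the band first moments; AM–GM in between.  See the module docstring. -/
theorem stub_normalFamily : ∀ (f : ℂ → ℝ) (R C : ℝ), Measurable f → (∀ z, |f z| ≤ C) →
    (∀ z, R < ‖z‖ → f z = 0) → ∫ z, f z = 0 → ∀ ρ : ℝ, 0 < ρ → ∃ M : ℝ, ∀ᶠ δ in 𝓝[>] (0 : ℝ),
    ∀ t : ℂ, ‖t‖ ≤ ρ → ‖(fun t : ℂ ↦ ∫ ω, (∏ᶠ u ∈ (siteLoopConfig δ ω).loops,
      2 * Complex.cos (t * ((u.nestingPhase f : ℝ) : ℂ) + (Real.pi : ℂ) / 3)) ∂(triSitePercolation half)) t‖ ≤ M := by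
  intro f R C hf hC hR h0 ρ hρ
  have hC0 : 0 ≤ C := nonneg_of_abs_le hC
  /- constants attached to `f` and `ρ` -/
  set κ₁ : ℝ := π * C
  have hκ₁0 : 0 ≤ κ₁ := by positivity
  set Bt : ℝ := 2 * Real.exp (ρ * (C * volume.real (closedBall (0 : ℂ) R)) + 2)
  have hBt0 : 0 < Bt := by positivity
  set r₀ : ℝ := min 1 (1 / (2 * Real.sqrt (3 * max C 1)))
  have hr₀pos : 0 < r₀ := lt_min one_pos (by positivity)
  set b : ℝ := min r₀ (1 / (2 * ρ * κ₁ + 2))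
  have hb0 : 0 < b := lt_min hr₀pos (by positivity)
  have hbr₀ : b ≤ r₀ := min_le_left _ _
  have hb1 : b ≤ 1 := hbr₀.trans (min_le_left _ _)
  have hbρ : ρ * κ₁ * b ^ 2 ≤ 1 / 2 := by
    have h2 : b * (2 * ρ * κ₁ + 2) ≤ 1 := (le_div_iff₀ (by positivity)).1 (min_le_right _ _)
    have h3 : 0 ≤ ρ * κ₁ := by positivity
    nlinarith [mul_le_mul_of_nonneg_left hb1 (mul_nonneg h3 hb0.le)]
  have hbρs : b ≤ |R| + 2 := by linarith [abs_nonneg R]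
  set R' : ℝ := max R b
  /- the keystone (big loops) and the band moment constants -/
  obtain ⟨CK, -, hK6⟩ := expMoment_ncard_bigLoops_meeting_le_ball tEns tEns_mem (2 * Real.log Bt)
    R' b hb0 (le_max_right _ _)
  obtain ⟨K₀, hK₀, hS1⟩ := stub_bandExpMoment tEns tEns_mem (4 * Real.sqrt 3 * ρ * κ₁ * (|R| + 2) ^ 2)
  obtain ⟨K₀', -, hS1'⟩ :=
    stub_bandExpMoment tEns tEns_mem (40 * ρ ^ 2 * (κ₁ ^ 2 * b ^ 2) * (|R| + 2) ^ 2)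
  obtain ⟨K₁, -, hS2⟩ := stub_bandFirstMoment tEns tEns_mem
  set EY : ℝ := Real.exp (K₀ * (4 * Real.sqrt 3 * ρ) ^ 2 * κ₁ ^ 2 * (|R| + 2) ^ 3 * b)
  set EZ : ℝ := Real.exp (40 * ρ ^ 2 * (K₁ * κ₁ ^ 2 * (|R| + 2) ^ 2 * b ^ 2)) *
    Real.exp (K₀' * (40 * ρ ^ 2) ^ 2 * (κ₁ ^ 2 * b ^ 2) ^ 2 * (|R| + 2) ^ 3 * b)
  refine ⟨1 / 2 * CK + 1 / 4 * EY + 1 / 4 * EZ, ?_⟩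
  filter_upwards [Ioo_mem_nhdsGT hb0] with δ ⟨hδ0, hδb⟩ t ht
  set F : tEns.Ω → ℂ := fun ω ↦ ∏ᶠ u ∈ (tEns.X δ ω).loops,
    2 * Complex.cos (t * ((u.nestingPhase f : ℝ) : ℂ) + (Real.pi : ℂ) / 3)
  show ‖∫ ω, F ω ∂tEns.P‖ ≤ 1 / 2 * CK + 1 / 4 * EY + 1 / 4 * EZ
  /- the statistics at mesh `δ` -/
  set D : Set ℂ := ball (0 : ℂ) (|R| + 2)
  set gs : UnbasedLoop ℂ → ℝ := fun u ↦
    if 0 ≤ diam u.range ∧ diam u.range < b then u.nestingPhase f else 0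
  set g2 : UnbasedLoop ℂ → ℝ := fun u ↦
    if 0 ≤ diam u.range ∧ diam u.range < b then u.nestingPhase f ^ 2 else 0
  set Θs : tEns.Ω → ℝ := fun ω ↦ ∑ᶠ u ∈ {u ∈ (tEns.X δ ω).loops | u.range ⊆ D}, gs u
  set Θ₂ : tEns.Ω → ℝ := fun ω ↦ ∑ᶠ u ∈ {u ∈ (tEns.X δ ω).loops | u.range ⊆ D}, g2 u
  set Nb : tEns.Ω → ℕ := fun ω ↦ {u ∈ (tEns.X δ ω).loops |
    (u.range ∩ closedBall (0 : ℂ) R').Nonempty ∧ b ≤ diam u.range}.ncard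
  set a₁ : ℝ := -(4 * Real.sqrt 3 * t.re) with ha₁
  set a₂ : ℝ := 40 * ρ ^ 2 with ha₂
  /- the pointwise majorant: complex UV sandwich + AM–GM -/
  have hpt : ∀ ω, ‖F ω‖ ≤ 1 / 2 * Real.exp (2 * Real.log Bt * (Nb ω : ℝ)) +
      1 / 4 * Real.exp (a₁ * Θs ω) + 1 / 4 * Real.exp (a₂ * Θ₂ ω) := by
    intro ω
    have hfin := ConeTilt.finite_loops_meeting tEns tEns_mem hδ0 ω R
    have hfin' := ConeTilt.finite_loops_meeting tEns tEns_mem hδ0 ω R'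
    have hX : Bt ^ Nb ω = Real.exp (Real.log Bt * Nb ω) := by
      rw [mul_comm, Real.exp_nat_mul, Real.exp_log hBt0]
    have h1 : ‖F ω‖ ≤ Real.exp (-(Real.sqrt 3 * t.re) * Θs ω + 10 * ρ ^ 2 * Θ₂ ω) *
        Real.exp (Real.log Bt * Nb ω) := by
      rw [← hX]
      exact nf_norm_finprod_le hC hR h0 hb1 hbρ (le_max_left _ _) hfin hfin' ht
    refine h1.trans ((nf_exp_three_le _ _ _).trans_eq ?_)
    rw [ha₁, ha₂]; ring_nf
  /- dominations of the band statistics -/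
  have hdom : ∀ u : UnbasedLoop ℂ, u.range ⊆ D →
      |gs u| ≤ κ₁ * diam u.range ^ 2 := fun u _ ↦ uva_band_dom_sq hC hR 0 b u
  have hdom4 : ∀ u : UnbasedLoop ℂ, u.range ⊆ D →
      |g2 u| ≤ κ₁ ^ 2 * diam u.range ^ 4 := fun u _ ↦ uva_band_dom_four hC hR 0 b u
  have hvan2 : ∀ u : UnbasedLoop ℂ, u.range ⊆ D → b ≤ diam u.range →
      g2 u = 0 := fun u _ hbu ↦ uva_band_vanish hbu _
  have hdom2 : ∀ u : UnbasedLoop ℂ, u.range ⊆ D →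
      |g2 u| ≤ κ₁ ^ 2 * b ^ 2 * diam u.range ^ 2 := by
    intro u hu
    rcases lt_or_ge (diam u.range) b with h | h
    · calc |g2 u| ≤ κ₁ ^ 2 * diam u.range ^ 4 := hdom4 u hu
        _ = κ₁ ^ 2 * diam u.range ^ 2 * diam u.range ^ 2 := by ring
        _ ≤ κ₁ ^ 2 * b ^ 2 * diam u.range ^ 2 := by
            gcongr _ * ?_ * _
            exact pow_le_pow_left₀ diam_nonneg h.le 2
    · rw [hvan2 u hu h, abs_zero]; positivity
  /- the keystone at mesh `δ` -/
  have hK6δ := hK6 0 1 δ one_pos hδ0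
  simp only [one_mul] at hK6δ
  /- exact centring and the exponential moment of `Θ_s` -/
  have hcs : ∫ ω', (∑ᶠ u ∈ {u ∈ (tEns.X δ ω').loops | u.range ⊆ D}, gs u) ∂tEns.P = 0 := by
    refine Eq.trans (integral_congr_ae (Eventually.of_forall fun ω ↦ ?_))
      (stub_bandCentring tEns tEns_mem f R C δ b hf hC hR h0 hδ0)
    have h1 := (sw_sandwich_of_finite hC hR h0 (a := 0) hbr₀ (tEns.X δ ω).loops
      (ConeTilt.finite_loops_meeting tEns tEns_mem hδ0 ω R)).1
    rw [uva_sep_band_zero] at h1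
    exact h1.symm
  have habs₁ : |a₁| ≤ 4 * Real.sqrt 3 * ρ := by
    rw [ha₁, abs_neg, abs_mul, abs_of_nonneg (by positivity : (0 : ℝ) ≤ 4 * Real.sqrt 3)]
    exact mul_le_mul_of_nonneg_left ((Complex.abs_re_le_norm t).trans ht) (by positivity)
  have horder₁ : |a₁| * κ₁ * (|R| + 2) ^ 2 ≤ 4 * Real.sqrt 3 * ρ * κ₁ * (|R| + 2) ^ 2 :=
    mul_le_mul_of_nonneg_right (mul_le_mul_of_nonneg_right habs₁ hκ₁0) (by positivity)
  have hS1s := hS1 0 (|R| + 2) κ₁ a₁ δ b D gs hδ0 hδb.le hbρs hκ₁0 subset_rfl hdom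
    (fun u _ hbu ↦ uva_band_vanish hbu _) horder₁
  simp only [hcs, sub_zero] at hS1s
  have hIY : Integrable (fun ω ↦ Real.exp (a₁ * Θs ω)) tEns.P := hS1s.1
  have hEY' : ∫ ω, Real.exp (a₁ * Θs ω) ∂tEns.P ≤ EY := by
    refine hS1s.2.trans (Real.exp_le_exp.2 ?_)
    have hsq : a₁ ^ 2 ≤ (4 * Real.sqrt 3 * ρ) ^ 2 := by
      rw [← sq_abs a₁]; exact pow_le_pow_left₀ (abs_nonneg _) habs₁ 2
    exact mul_le_mul_of_nonneg_right (mul_le_mul_of_nonneg_right (mul_le_mul_of_nonneg_right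
      (mul_le_mul_of_nonneg_left hsq hK₀.le) (sq_nonneg _)) (by positivity)) hb0.le
  /- first and exponential moments of `Θ₂` -/
  have hS2' := hS2 0 (|R| + 2) (κ₁ ^ 2) δ b D g2 hδ0 hδb.le hbρs (by positivity) subset_rfl hdom4
    hvan2
  have hS1z := hS1' 0 (|R| + 2) (κ₁ ^ 2 * b ^ 2) a₂ δ b D g2 hδ0 hδb.le hbρs (by positivity)
    subset_rfl hdom2 hvan2 (by rw [ha₂, abs_of_nonneg (by positivity : (0 : ℝ) ≤ 40 * ρ ^ 2)])
  set m : ℝ := ∫ ω', (∑ᶠ u ∈ {u ∈ (tEns.X δ ω').loops | u.range ⊆ D}, g2 u) ∂tEns.P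
  have hm_le : m ≤ K₁ * κ₁ ^ 2 * (|R| + 2) ^ 2 * b ^ 2 :=
    (le_abs_self m).trans (abs_integral_le_integral_abs.trans hS2'.2)
  have hexp2 : ∀ ω, Real.exp (a₂ * Θ₂ ω) = Real.exp (a₂ * m) * Real.exp (a₂ * (Θ₂ ω - m)) :=
    fun ω ↦ by rw [← Real.exp_add]; congr 1; ring
  have hIZ : Integrable (fun ω ↦ Real.exp (a₂ * Θ₂ ω)) tEns.P := by
    simp_rw [hexp2]
    exact hS1z.1.const_mul _
  have hEZ' : ∫ ω, Real.exp (a₂ * Θ₂ ω) ∂tEns.P ≤ EZ := by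
    simp_rw [hexp2]
    rw [integral_const_mul]
    refine mul_le_mul (Real.exp_le_exp.2 ?_) hS1z.2 (integral_nonneg fun _ ↦ (Real.exp_pos _).le)
      (Real.exp_pos _).le
    exact mul_le_mul_of_nonneg_left hm_le (by positivity)
  /- assembly -/
  have hI1 : Integrable (fun ω ↦ 1 / 2 * Real.exp (2 * Real.log Bt * (Nb ω : ℝ))) tEns.P :=
    hK6δ.1.const_mul _
  have hI2 : Integrable (fun ω ↦ 1 / 4 * Real.exp (a₁ * Θs ω)) tEns.P := hIY.const_mul _
  have hI3 : Integrable (fun ω ↦ 1 / 4 * Real.exp (a₂ * Θ₂ ω)) tEns.P := hIZ.const_mul _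
  have hI12 : Integrable (fun ω ↦ 1 / 2 * Real.exp (2 * Real.log Bt * (Nb ω : ℝ)) +
      1 / 4 * Real.exp (a₁ * Θs ω)) tEns.P := hI1.add hI2
  calc ‖∫ ω, F ω ∂tEns.P‖ ≤ ∫ ω, ‖F ω‖ ∂tEns.P := norm_integral_le_integral_norm _
    _ ≤ ∫ ω, (1 / 2 * Real.exp (2 * Real.log Bt * (Nb ω : ℝ)) + 1 / 4 * Real.exp (a₁ * Θs ω) +
          1 / 4 * Real.exp (a₂ * Θ₂ ω)) ∂tEns.P :=
        integral_mono_of_nonneg (Eventually.of_forall fun _ ↦ norm_nonneg _) (hI12.add hI3)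
          (Eventually.of_forall hpt)
    _ ≤ 1 / 2 * CK + 1 / 4 * EY + 1 / 4 * EZ := by
        rw [integral_add hI12 hI3, integral_add hI1 hI2, integral_const_mul, integral_const_mul,
          integral_const_mul]
        gcongr
        exact hK6δ.2

end Summit.CriticalPhenomena.CardyFormulaZ2.Cruxes.MagicFormulaT.LineSketch

end
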